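import Literature.Analysis.FluidPDE.QuasiSelfSimilarMoveSP04Checks1
import Literature.Analysis.FluidPDE.QuasiSelfSimilarMoveSC
import HarnessLib

/-!
# Straight move, phase 4: assembled checks and the slot

Topic `Literature/Analysis/FluidPDE`. Emitted data / kernel certificates of the explicit straight generating
move (`S`) in the typed-chain model, under the contract of `PlanarGeneratorAssembly.lean`
(`acm_compatible_blocks_of_slots`). Generated by the author's emitter from the exact rational design;
no named facts, every theorem is decided in the kernel or assembled from decided chunks. [folklore]

## References

* G. Alberti, G. Crippa, A. L. Mazzucato, *Exponential self-similar mixing by incompressible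
  flows*, J. Amer. Math. Soc. 32 (2019), 445–490, §8 (arXiv:1605.02090).
-/

noncomputable section

namespace Literature.Analysis.FluidPDE.QuasiSelfSimilar.MoveS

open PlanarKinematics QuasiSelfSimilar

set_option maxHeartbeats 4000000 in
/-- Node count. [folklore] -/
theorem P04_K : P04.K = 43 := by decide +kernel

/-- Kernel check of element validity (all nodes). [folklore] -/
theorem P04_valid : ∀ k < 43, (P04.node k).e.validB = true :=
  (forall_lt_of_chunk (forall_lt_of_chunk (forall_lt_zero fun k => (P04.node k).e.validB = true) P04_valid_c0) P04_valid_c1)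

/-- Kernel check of positivity (all nodes). [folklore] -/
theorem P04_pos : ∀ k < 43, (decide (0 < (P04.node k).box.ρ) && decide (0 < (P04.node k).step.len)) = true :=
  (forall_lt_of_chunk (forall_lt_of_chunk (forall_lt_zero fun k => (decide (0 < (P04.node k).box.ρ) && decide (0 < (P04.node k).step.len)) = true) P04_pos_c0) P04_pos_c1)

/-- Kernel check of the node geometry (orders, pieces, cover tags) (all nodes). [folklore] -/
theorem P04_geo : ∀ k < 43, P04.geomAtB k = true :=
  (forall_lt_of_chunk (forall_lt_of_chunk (forall_lt_zero fun k => P04.geomAtB k = true) P04_geo_c0) P04_geo_c1)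

/-- Kernel check of box separation rows (all nodes). [folklore] -/
theorem P04_sep : ∀ k < 43, P04.sepRowB k = true :=
  (forall_lt_of_chunk (forall_lt_of_chunk (forall_lt_zero fun k => P04.sepRowB k = true) P04_sep_c0) P04_sep_c1)

/-- Kernel check of junction agreement (all nodes). [folklore] -/
theorem P04_agr : ∀ k < 43, P04.agreeAtB k = true :=
  (forall_lt_of_chunk (forall_lt_of_chunk (forall_lt_zero fun k => P04.agreeAtB k = true) P04_agr_c0) P04_agr_c1)

/-- `elemsValidB` of phase 4. [folklore] -/
theorem P04_elemsValidB : P04.elemsValidB = true :=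
  PhaseQ.elemsValidB_of_forall (by decide +kernel) (by rw [P04_K]; exact P04_valid)

/-- `allPosB` of phase 4. [folklore] -/
theorem P04_allPosB : P04.allPosB = true :=
  PhaseQ.allPosB_of_forall (by rw [P04_K]; exact P04_pos)

/-- `geomB` of phase 4. [folklore] -/
theorem P04_geomB : P04.geomB = true :=
  PhaseQ.geomB_of_geomAtB P04_elemsValidB P04_allPosB (by rw [P04_K]; exact P04_geo)

/-- `boxSepB` of phase 4. [folklore] -/
theorem P04_boxSepB : P04.boxSepB = true :=
  PhaseQ.boxSepB_of_sepRowB (by rw [P04_K]; exact P04_sep)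

/-- `agreeB` of phase 4. [folklore] -/
theorem P04_agreeB : P04.agreeB = true :=
  PhaseQ.agreeB_of_agreeAtB (by rw [P04_K]; exact P04_agr)

set_option maxHeartbeats 4000000 in
/-- `gateOKB` of phase 4 on its slot. [folklore] -/
theorem P04_gateOKB : P04.gateOKB C_S stub04 (mkRat (4) 15) = true := by decide +kernel

/-- Slot 4 of the straight move. [folklore] -/
def slot04 : Slot := ⟨P04, (mkRat (4) 15), stub04, rc04, rc04'⟩
/-- Slot test of slot 4. [folklore] -/
theorem slot04_okB : slot04.okB C_S (genGate .S) (mkRat (3) 200) = true :=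
  Slot.okB_intro (s := slot04) P04_geomB P04_boxSepB P04_agreeB P04_gateOKB rfl (by decide)

end Literature.Analysis.FluidPDE.QuasiSelfSimilar.MoveS

end
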